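import Literature.NumberTheory.Transcendental.CyclotomicSimplexRep
import Literature.NumberTheory.Transcendental.KZProductIdeal
import Literature.NumberTheory.Transcendental.KZLogCalculusProofs
import Literature.NumberTheory.Transcendental.KZSemiCanonicalReductionProofs
import Summits.KontsevichZagierPeriods.KontsevichZagierPeriods.Theorems.MzvKernelInKZTwoPosetsShuffleProductAux

/-!
# `ZhaoRelationInKZ` (stmt-KontsevichZagierPeriods-9433, route `OctahedralSymmetry`),
# line `Sketch`: stub `stub_shuffle` — the shuffle `(1) × (2)` of level-4 words is a dissection

For a convergent letter `a` and a convergent two-letter word `(v₀, v₁)` (letters `Fin 5` of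
`CyclotomicSimplexRep.lean`: `m ≤ 3` is the pole `i^m`, `4` the pole `0`), the product of the
level-4 iterated integrals `I(a) · I(v₀, v₁)` is the sum of the three interleavings
`I(a, v₀, v₁) + I(v₀, a, v₁) + I(v₀, v₁, a)` — inside the Kontsevich–Zagier calculus, on real
and imaginary parts.  The four real Fubini products (`KZ.IntegralRep.prod`)
`[Δ₁, Re_a] · [Δ₂, Re_V]`, `[Δ₁, Im_a] · [Δ₂, Im_V]`, `[Δ₁, Re_a] · [Δ₂, Im_V]`,
`[Δ₁, Im_a] · [Δ₂, Re_V]` live on `Δ₁ × Δ₂ = (0,1) × {1 > y₀ > y₁ > 0} ⊆ ℝ³`, which is, off the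
null walls `{x₀ = y₀}`, `{x₀ = y₁}`, the disjoint union of the three SHUFFLE CELLS
`{z | z ∘ e ∈ Δ₃}` of the sorting permutations `e = id`, `(0 1)`, `(0 ↦ 1 ↦ 2 ↦ 0)` of `Fin 3`
(the coordinate shuffles of `1 + 2`, in the sense of `MzvKernelInKZTwoPosetsShuffleProductAux.lean`,
whose cell geometry — cells inside the product, pairwise disjoint, covering off the walls, walls
null — is reused verbatim):

* rule (1a) (iterated domain additivity, `KZ.of_sub_sum_of_mem_relations`): each of the four
  products is congruent to the sum of its restrictions to the three cells (`zhaoShuffle_dissect`);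
* rules (1b) + (2) on a cell (`zhaoShuffle_cell`): the complex word integrand of the interleaved
  word `W`, read along the sorting permutation, is `f_a(z₀) · (f_{v₀}(z₁) f_{v₁}(z₂))` pointwise,
  so `Re = Re·Re − Im·Im` and `Im = Re·Im + Im·Re` of the factors (integrand additivity), and the
  cell representation is the coordinate permutation (`KZ.IntegralRep.reindex`,
  `KZ.of_sub_of_reindex_mem_relations`) of the simplex representation `KZ.levelFourRepRe/Im W`;
* assembly (`stub_shuffle`).

References: M. Kontsevich, D. Zagier, *Periods* (2001), §1.2 (rules (1), (2)); J. Zhao,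
*Standard relations of multiple polylogarithm values at roots of unity*, Doc. Math. 15 (2010),
§2 Lemma 2.2 (the shuffle product of iterated integrals); M. Eie, *The Theory of Multiple Zeta
Values with Applications in Combinatorics* (2013), §1.2.
-/

noncomputable section

open Set MeasureTheory
open Literature.NumberTheory.Transcendental Literature.NumberTheory.Transcendental.KZ
open Summit.KontsevichZagierPeriods.MzvKernelInKZ.TwoPosets

namespace Summit.KontsevichZagierPeriods.OctahedralSymmetry.ZhaoRelationInKZ

/-! ## Rule (1a): the shuffle cells dissect a product `Δ₁ × Δ₂` -/

/-- **Dissection of `Δ₁ × Δ₂` into shuffle cells** (rule (1a), iterated: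
`KZ.of_sub_sum_of_mem_relations`).  Let `E` enumerate bijectively (through `i ↦ ofFn (E i)`)
the coordinate shuffles of `1 + 2`, let `r`, `s` be representations on the open ordered
simplices `Δ₁`, `Δ₂`, and let `R i` be representations on the cells `{z | z ∘ E i ∈ Δ₃}` lying
in `Δ₁ × Δ₂` and carrying the product integrand.  Then `[r · s] − Σᵢ [R i] ∈ KZ.relations`:
the cells are pairwise disjoint (`ofFn_eq_of_comp_mem_simplex`) and cover the product off the
null walls `{x₀ = yⱼ}` (`exists_comp_mem_simplex`, `volume_setOf_apply_eq_apply`).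
[cite: KontsevichZagier2001, §1.2 rule (1)] -/
theorem zhaoShuffle_dissect {ι : Type*} [Fintype ι] (E : ι → (Fin 3 ≃ Fin 3))
    (hinj : ∀ i j, List.ofFn (E i) = List.ofFn (E j) → i = j)
    (hsurj : ∀ w ∈ MZV.shuffleWord (List.ofFn (Fin.castAdd 2 : Fin 1 → Fin 3))
      (List.ofFn (Fin.natAdd 1 : Fin 2 → Fin 3)), ∃ i, List.ofFn (E i) = w)
    (r : IntegralRep 1) (s : IntegralRep 2) (hr : r.domain = openOrderedSimplex 1)
    (hs : s.domain = openOrderedSimplex 2) (R : ι → IntegralRep 3)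
    (hRd : ∀ i, (R i).domain = {z | (fun k => z (E i k)) ∈ openOrderedSimplex 3})
    (hRsub : ∀ i, (R i).domain ⊆ (r.prod s).domain)
    (hRi : ∀ i, (R i).integrand = (r.prod s).integrand) :
    of (r.prod s) - ∑ i, of (R i) ∈ relations := by
  classical
  refine of_sub_sum_of_mem_relations (n := 3) Finset.univ (r.prod s) R (fun i _ => ?_)
    (fun i _ z _ => ?_) ?_ ?_
  · -- the cells lie in the product
    exact measure_mono_null (fun z hz => (hz.2 (hRsub i hz.1)).elim) measure_empty
  · -- the cells carry the product integrand
    exact congrFun (hRi i) z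
  · -- the cells cover the product off the null walls `{x₀ = yⱼ}`
    refine measure_mono_null (fun z hz => ?_)
      (measure_iUnion_null_iff.2 fun i : Fin 1 => measure_iUnion_null_iff.2 fun j : Fin 2 =>
        volume_setOf_apply_eq_apply (n := 3) (i := Fin.castAdd 2 i) (j := Fin.natAdd 1 j)
          fun h => absurd (congrArg Fin.val h) (by
            have := i.isLt
            simp only [Fin.val_castAdd, Fin.val_natAdd]
            omega))
    obtain ⟨hzP, hz⟩ := hz
    have hx : (fun i => z (Fin.castAdd 2 i)) ∈ openOrderedSimplex 1 := by
      have h := hzP.1; rwa [hr] at h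
    have hy : (fun j => z (Fin.natAdd 1 j)) ∈ openOrderedSimplex 2 := by
      have h := hzP.2; rwa [hs] at h
    by_contra hne
    simp only [mem_iUnion, mem_setOf_eq, not_exists] at hne
    obtain ⟨e₀, he₀, hz₀⟩ := exists_comp_mem_simplex (a := 1) (b := 2) hx hy hne
    obtain ⟨i, hi⟩ := hsurj _ he₀
    have hei : E i = e₀ := Equiv.ext (congrFun (List.ofFn_injective hi))
    refine hz (mem_iUnion₂.2 ⟨i, Finset.mem_univ _, ?_⟩)
    rw [hRd i, mem_setOf_eq, hei]
    exact hz₀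
  · -- the cells are pairwise disjoint
    intro i _ j _ hij
    rw [hRd i, hRd j]
    have he : {z : Fin 3 → ℝ | (fun k => z (E i k)) ∈ openOrderedSimplex 3} ∩
        {z | (fun k => z (E j k)) ∈ openOrderedSimplex 3} = ∅ :=
      eq_empty_of_forall_notMem fun z hz =>
        hij (hinj i j (ofFn_eq_of_comp_mem_simplex hz.1 hz.2))
    rw [he, measure_empty]

/-! ## Rules (1b) + (2): one shuffle cell -/

/-- **One cell.**  Let `W` be a convergent word and `e : Fin |W| ≃ Fin 3` a permutation along
which the complex word integrand of `W` factors as `f_a(z₀) · (f_{v₀}(z₁) f_{v₁}(z₂))`, and let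
`X₁, …, X₄` be representations on the cell `{z | z ∘ e ∈ Δ_{|W|}}` carrying the integrands of the
four real products `Re_a ⊗ Re_V`, `Im_a ⊗ Im_V`, `Re_a ⊗ Im_V`, `Im_a ⊗ Re_V`.  Then
`[X₁] − [X₂] − [Δ, Re_W]` and `[X₃] + [X₄] − [Δ, Im_W]` are KZ relations: pointwise
`Re(f_a F_V) = Re·Re − Im·Im`, `Im(f_a F_V) = Re·Im + Im·Re` (rule (1b), `KZ.integrandAddRel`)
against the reindexed representations `(KZ.levelFourRepRe/Im W).reindex e`, which are ONE
coordinate permutation away from the simplex representations (rule (2),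
`KZ.of_sub_of_reindex_mem_relations`). [cite: KontsevichZagier2001, §1.2 rule (2)] -/
theorem zhaoShuffle_cell {a v₀ v₁ : Fin 5} (ha : LevelFour.IsConvergent [a])
    (hv : LevelFour.IsConvergent [v₀, v₁]) {W : List (Fin 5)} (hW : LevelFour.IsConvergent W)
    (e : Fin W.length ≃ Fin 3)
    (hWe : ∀ z : Fin 3 → ℝ, levelFourIntegrandC W (fun k => z (e k)) =
      levelFourIntegrandC [a] (fun i : Fin 1 => z (Fin.castAdd 2 i)) *
        levelFourIntegrandC [v₀, v₁] (fun j : Fin 2 => z (Fin.natAdd 1 j)))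
    (X₁ X₂ X₃ X₄ : IntegralRep 3)
    (hd₁ : X₁.domain = {z | (fun k => z (e k)) ∈ openOrderedSimplex W.length})
    (hd₂ : X₂.domain = {z | (fun k => z (e k)) ∈ openOrderedSimplex W.length})
    (hd₃ : X₃.domain = {z | (fun k => z (e k)) ∈ openOrderedSimplex W.length})
    (hd₄ : X₄.domain = {z | (fun k => z (e k)) ∈ openOrderedSimplex W.length})
    (hi₁ : X₁.integrand = (IntegralRep.prod (n := 1) (m := 2)
      (levelFourRepRe [a] (integrableOn_levelFourIntegrandC ha))
      (levelFourRepRe [v₀, v₁] (integrableOn_levelFourIntegrandC hv))).integrand)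
    (hi₂ : X₂.integrand = (IntegralRep.prod (n := 1) (m := 2)
      (levelFourRepIm [a] (integrableOn_levelFourIntegrandC ha))
      (levelFourRepIm [v₀, v₁] (integrableOn_levelFourIntegrandC hv))).integrand)
    (hi₃ : X₃.integrand = (IntegralRep.prod (n := 1) (m := 2)
      (levelFourRepRe [a] (integrableOn_levelFourIntegrandC ha))
      (levelFourRepIm [v₀, v₁] (integrableOn_levelFourIntegrandC hv))).integrand)
    (hi₄ : X₄.integrand = (IntegralRep.prod (n := 1) (m := 2)
      (levelFourRepIm [a] (integrableOn_levelFourIntegrandC ha))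
      (levelFourRepRe [v₀, v₁] (integrableOn_levelFourIntegrandC hv))).integrand) :
    of X₁ - of X₂ - of (levelFourRepRe W (integrableOn_levelFourIntegrandC hW)) ∈ relations ∧
      of X₃ + of X₄ - of (levelFourRepIm W (integrableOn_levelFourIntegrandC hW)) ∈
        relations := by
  -- the pointwise identities `Re·Re = Im·Im + Re(f_a F_V)`, `Im(f_a F_V) = Re·Im + Im·Re`
  have key : ∀ z : Fin 3 → ℝ,
      X₁.integrand z = X₂.integrand z +
          ((levelFourRepRe W (integrableOn_levelFourIntegrandC hW)).reindex e).integrand z ∧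
        ((levelFourRepIm W (integrableOn_levelFourIntegrandC hW)).reindex e).integrand z =
          X₃.integrand z + X₄.integrand z := by
    intro z
    simp only [hi₁, hi₂, hi₃, hi₄, IntegralRep.prod_integrand_eq, IntegralRep.prodFun_apply,
      IntegralRep.reindex_integrand, levelFourRepRe_integrand, levelFourRepIm_integrand,
      levelFourIntegrandRe, levelFourIntegrandIm]
    constructor
    · rw [hWe z, Complex.mul_re]; ring
    · rw [hWe z, Complex.mul_im]
  -- rule (1b) on the cell
  have h1 : of X₁ - of X₂ -
      of ((levelFourRepRe W (integrableOn_levelFourIntegrandC hW)).reindex e) ∈ relations :=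
    integrandAddRel_subset_relations ⟨3, X₁, X₂,
      (levelFourRepRe W (integrableOn_levelFourIntegrandC hW)).reindex e,
      hd₂.trans hd₁.symm, hd₁.symm, fun z _ => (key z).1, rfl⟩
  have h2 : of ((levelFourRepIm W (integrableOn_levelFourIntegrandC hW)).reindex e) -
      of X₃ - of X₄ ∈ relations :=
    integrandAddRel_subset_relations
      ⟨3, (levelFourRepIm W (integrableOn_levelFourIntegrandC hW)).reindex e, X₃, X₄,
        hd₃, hd₄, fun z _ => (key z).2, rfl⟩
  -- rule (2): the cell is a coordinate permutation of the simplex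
  have h3 := of_sub_of_reindex_mem_relations
    (levelFourRepRe W (integrableOn_levelFourIntegrandC hW)) e
  have h4 := of_sub_of_reindex_mem_relations
    (levelFourRepIm W (integrableOn_levelFourIntegrandC hW)) e
  constructor
  · convert relations.sub_mem h1 h3 using 1
    abel
  · convert relations.sub_mem (relations.neg_mem h2) h4 using 1
    abel

/-! ## Assembly -/

/-- **The shuffle `(1) × (2)` is a dissection**, with the Fubini products typed in dimension
`1 + 2`: the real and imaginary parts of
`I(a) · I(v₀, v₁) − (I(a,v₀,v₁) + I(v₀,a,v₁) + I(v₀,v₁,a))` are KZ relations — four dissections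
(rule (1a), `zhaoShuffle_dissect`, along the three sorting permutations `id`, `(0 1)`,
`0 ↦ 1 ↦ 2 ↦ 0`, which enumerate the coordinate shuffles of `1 + 2` by `decide`), three cells
(rules (1b) + (2), `zhaoShuffle_cell`), recombined in the free abelian group.
[cite: Zhao2010, §2 Lemma 2.2] -/
theorem zhaoShuffle_lit (a v₀ v₁ : Fin 5) (ha : LevelFour.IsConvergent [a])
    (hv : LevelFour.IsConvergent [v₀, v₁]) (h₁ : LevelFour.IsConvergent [a, v₀, v₁])
    (h₂ : LevelFour.IsConvergent [v₀, a, v₁]) (h₃ : LevelFour.IsConvergent [v₀, v₁, a]) :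
    of (IntegralRep.prod (n := 1) (m := 2)
          (levelFourRepRe [a] (integrableOn_levelFourIntegrandC ha))
          (levelFourRepRe [v₀, v₁] (integrableOn_levelFourIntegrandC hv)))
      - of (IntegralRep.prod (n := 1) (m := 2)
          (levelFourRepIm [a] (integrableOn_levelFourIntegrandC ha))
          (levelFourRepIm [v₀, v₁] (integrableOn_levelFourIntegrandC hv)))
      - (of (levelFourRepRe [a, v₀, v₁] (integrableOn_levelFourIntegrandC h₁))
        + of (levelFourRepRe [v₀, a, v₁] (integrableOn_levelFourIntegrandC h₂))
        + of (levelFourRepRe [v₀, v₁, a] (integrableOn_levelFourIntegrandC h₃))) ∈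
      relations ∧
    of (IntegralRep.prod (n := 1) (m := 2)
          (levelFourRepRe [a] (integrableOn_levelFourIntegrandC ha))
          (levelFourRepIm [v₀, v₁] (integrableOn_levelFourIntegrandC hv)))
      + of (IntegralRep.prod (n := 1) (m := 2)
          (levelFourRepIm [a] (integrableOn_levelFourIntegrandC ha))
          (levelFourRepRe [v₀, v₁] (integrableOn_levelFourIntegrandC hv)))
      - (of (levelFourRepIm [a, v₀, v₁] (integrableOn_levelFourIntegrandC h₁))
        + of (levelFourRepIm [v₀, a, v₁] (integrableOn_levelFourIntegrandC h₂))
        + of (levelFourRepIm [v₀, v₁, a] (integrableOn_levelFourIntegrandC h₃))) ∈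
      relations := by
  -- the complex integrands of the short words, expanded
  have hC1 : ∀ (x : Fin 5) (t : Fin 1 → ℝ),
      levelFourIntegrandC [x] t = levelFourFactor x (t 0) := by
    intro x t
    show ∏ j : Fin 1, levelFourFactor ([x].get j) (t j) = _
    rw [Fin.prod_univ_one]; rfl
  have hC2 : ∀ (x y : Fin 5) (t : Fin 2 → ℝ),
      levelFourIntegrandC [x, y] t = levelFourFactor x (t 0) * levelFourFactor y (t 1) := by
    intro x y t
    show ∏ j : Fin 2, levelFourFactor ([x, y].get j) (t j) = _
    rw [Fin.prod_univ_two]; rfl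
  have hC3 : ∀ (x y w : Fin 5) (t : Fin 3 → ℝ), levelFourIntegrandC [x, y, w] t =
      levelFourFactor x (t 0) * levelFourFactor y (t 1) * levelFourFactor w (t 2) := by
    intro x y w t
    show ∏ j : Fin 3, levelFourFactor ([x, y, w].get j) (t j) = _
    rw [Fin.prod_univ_three]; rfl
  -- the three sorting permutations of `Fin 3`, enumerating the coordinate shuffles of `1 + 2`
  obtain ⟨E, hE0, hE1, hE2, hmem, hinj, hsurj⟩ : ∃ E : Fin 3 → (Fin 3 ≃ Fin 3),
      E 0 = Equiv.refl _ ∧ E 1 = Equiv.swap 0 1 ∧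
      E 2 = (Equiv.swap 1 2).trans (Equiv.swap 0 1) ∧
      (∀ i, List.ofFn (E i) ∈ MZV.shuffleWord (List.ofFn (Fin.castAdd 2 : Fin 1 → Fin 3))
        (List.ofFn (Fin.natAdd 1 : Fin 2 → Fin 3))) ∧
      (∀ i j, List.ofFn (E i) = List.ofFn (E j) → i = j) ∧
      (∀ w ∈ MZV.shuffleWord (List.ofFn (Fin.castAdd 2 : Fin 1 → Fin 3))
        (List.ofFn (Fin.natAdd 1 : Fin 2 → Fin 3)), ∃ i, List.ofFn (E i) = w) :=
    ⟨![Equiv.refl _, Equiv.swap 0 1, (Equiv.swap 1 2).trans (Equiv.swap 0 1)], rfl, rfl, rfl,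
      by decide, by decide, by decide⟩
  -- rule (1a): a product of a `Δ₁`- and a `Δ₂`-representation is dissected by its
  -- restrictions to the three cells
  have hX : ∀ (r : IntegralRep 1) (s : IntegralRep 2), r.domain = openOrderedSimplex 1 →
      s.domain = openOrderedSimplex 2 →
      ∃ X : Fin 3 → IntegralRep 3,
        (∀ i, (X i).domain = {z | (fun k => z (E i k)) ∈ openOrderedSimplex 3}) ∧
        (∀ i, (X i).integrand = (r.prod s).integrand) ∧
        of (r.prod s) - (of (X 0) + of (X 1) + of (X 2)) ∈ relations := by
    intro r s hr hs
    have hsC : ∀ i, Literature.ModelTheory.ExponentialFields.IsSemialgebraic ℚ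
        {z : Fin 3 → ℝ | (fun k => z (E i k)) ∈ openOrderedSimplex 3} :=
      fun i => (isSemialgebraic_openOrderedSimplex 3).preimage_comp (E i)
    have hsub : ∀ i, {z : Fin 3 → ℝ | (fun k => z (E i k)) ∈ openOrderedSimplex 3} ⊆
        (r.prod s).domain := by
      intro i z hz
      show (fun i => z (Fin.castAdd 2 i)) ∈ r.domain ∧
        (fun j => z (Fin.natAdd 1 j)) ∈ s.domain
      rw [hr, hs]
      exact mem_simplex_of_comp_mem_simplex (hmem i) hz
    have h := zhaoShuffle_dissect E hinj hsurj r s hr hs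
      (fun i => (r.prod s).restrict _ (hsC i) (hsub i)) (fun i => rfl) hsub (fun i => rfl)
    rw [Fin.sum_univ_three] at h
    exact ⟨fun i => (r.prod s).restrict _ (hsC i) (hsub i), fun i => rfl, fun i => rfl, h⟩
  obtain ⟨XRR, hdRR, hiRR, hRR⟩ := hX (levelFourRepRe [a] (integrableOn_levelFourIntegrandC ha))
    (levelFourRepRe [v₀, v₁] (integrableOn_levelFourIntegrandC hv)) rfl rfl
  obtain ⟨XJJ, hdJJ, hiJJ, hJJ⟩ := hX (levelFourRepIm [a] (integrableOn_levelFourIntegrandC ha))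
    (levelFourRepIm [v₀, v₁] (integrableOn_levelFourIntegrandC hv)) rfl rfl
  obtain ⟨XRJ, hdRJ, hiRJ, hRJ⟩ := hX (levelFourRepRe [a] (integrableOn_levelFourIntegrandC ha))
    (levelFourRepIm [v₀, v₁] (integrableOn_levelFourIntegrandC hv)) rfl rfl
  obtain ⟨XJR, hdJR, hiJR, hJR⟩ := hX (levelFourRepIm [a] (integrableOn_levelFourIntegrandC ha))
    (levelFourRepRe [v₀, v₁] (integrableOn_levelFourIntegrandC hv)) rfl rfl
  -- rules (1b) + (2) on the three cells
  obtain ⟨h0re, h0im⟩ := zhaoShuffle_cell ha hv h₁ (E 0) (fun z => by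
      rw [hE0, hC3, hC1, hC2]
      show levelFourFactor a (z 0) * levelFourFactor v₀ (z 1) * levelFourFactor v₁ (z 2) =
        levelFourFactor a (z 0) * (levelFourFactor v₀ (z 1) * levelFourFactor v₁ (z 2))
      ring)
    (XRR 0) (XJJ 0) (XRJ 0) (XJR 0) (hdRR 0) (hdJJ 0) (hdRJ 0) (hdJR 0)
    (hiRR 0) (hiJJ 0) (hiRJ 0) (hiJR 0)
  obtain ⟨h1re, h1im⟩ := zhaoShuffle_cell ha hv h₂ (E 1) (fun z => by
      rw [hE1, hC3, hC1, hC2]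
      show levelFourFactor v₀ (z 1) * levelFourFactor a (z 0) * levelFourFactor v₁ (z 2) =
        levelFourFactor a (z 0) * (levelFourFactor v₀ (z 1) * levelFourFactor v₁ (z 2))
      ring)
    (XRR 1) (XJJ 1) (XRJ 1) (XJR 1) (hdRR 1) (hdJJ 1) (hdRJ 1) (hdJR 1)
    (hiRR 1) (hiJJ 1) (hiRJ 1) (hiJR 1)
  obtain ⟨h2re, h2im⟩ := zhaoShuffle_cell ha hv h₃ (E 2) (fun z => by
      rw [hE2, hC3, hC1, hC2]
      show levelFourFactor v₀ (z 1) * levelFourFactor v₁ (z 2) * levelFourFactor a (z 0) =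
        levelFourFactor a (z 0) * (levelFourFactor v₀ (z 1) * levelFourFactor v₁ (z 2))
      ring)
    (XRR 2) (XJJ 2) (XRJ 2) (XJR 2) (hdRR 2) (hdJJ 2) (hdRJ 2) (hdJR 2)
    (hiRR 2) (hiJJ 2) (hiRJ 2) (hiJR 2)
  -- assembly in the free abelian group
  constructor
  · convert relations.add_mem (relations.sub_mem hRR hJJ)
      (relations.add_mem (relations.add_mem h0re h1re) h2re) using 1
    abel
  · convert relations.add_mem (relations.add_mem hRJ hJR)
      (relations.add_mem (relations.add_mem h0im h1im) h2im) using 1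
    abel

/-- **Stub `stub_shuffle`** (shuffle `(1) × (2)` is a dissection): for a convergent letter `a`
and a convergent word `(v₀, v₁)`, the real and the imaginary parts of
`I(a) · I(v₀, v₁) − (I(a, v₀, v₁) + I(v₀, a, v₁) + I(v₀, v₁, a))` are KZ relations —
`(0,1) × Δ₂` is, up to the null walls `{z₀ = z₁}`, `{z₀ = z₂}`, the disjoint union of three
coordinate permutations of `Δ₃` (rule (1a) thrice per product, rule (2) once per cell), and on
each cell `Re/Im (f_a · F_V)` is the word integrand of the interleaved word (rule (1b)); this is
`zhaoShuffle_lit`, the products being literally the same terms. [cite: Zhao2010, §2 Lemma 2.2] -/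
theorem stub_shuffle (a v₀ v₁ : Fin 5) (ha : LevelFour.IsConvergent [a])
    (hv : LevelFour.IsConvergent [v₀, v₁]) (h₁ : LevelFour.IsConvergent [a, v₀, v₁])
    (h₂ : LevelFour.IsConvergent [v₀, a, v₁]) (h₃ : LevelFour.IsConvergent [v₀, v₁, a]) :
    of ((levelFourRepRe [a] (integrableOn_levelFourIntegrandC ha)).prod
          (levelFourRepRe [v₀, v₁] (integrableOn_levelFourIntegrandC hv)))
      - of ((levelFourRepIm [a] (integrableOn_levelFourIntegrandC ha)).prod
          (levelFourRepIm [v₀, v₁] (integrableOn_levelFourIntegrandC hv)))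
      - (of (levelFourRepRe [a, v₀, v₁] (integrableOn_levelFourIntegrandC h₁))
        + of (levelFourRepRe [v₀, a, v₁] (integrableOn_levelFourIntegrandC h₂))
        + of (levelFourRepRe [v₀, v₁, a] (integrableOn_levelFourIntegrandC h₃))) ∈ relations ∧
    of ((levelFourRepRe [a] (integrableOn_levelFourIntegrandC ha)).prod
          (levelFourRepIm [v₀, v₁] (integrableOn_levelFourIntegrandC hv)))
      + of ((levelFourRepIm [a] (integrableOn_levelFourIntegrandC ha)).prod
          (levelFourRepRe [v₀, v₁] (integrableOn_levelFourIntegrandC hv)))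
      - (of (levelFourRepIm [a, v₀, v₁] (integrableOn_levelFourIntegrandC h₁))
        + of (levelFourRepIm [v₀, a, v₁] (integrableOn_levelFourIntegrandC h₂))
        + of (levelFourRepIm [v₀, v₁, a] (integrableOn_levelFourIntegrandC h₃))) ∈ relations :=
  zhaoShuffle_lit a v₀ v₁ ha hv h₁ h₂ h₃

end Summit.KontsevichZagierPeriods.OctahedralSymmetry.ZhaoRelationInKZ
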